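import Mathlib.Analysis.Calculus.LocalExtr.Rolle
import Literature.Analysis.SpecialFunctions.LaguerreSoninOscillatory
import Literature.Analysis.SpecialFunctions.LaguerreSoninZeros
import HarnessLib

/-!
# Test points of the Szegő normal form `w = e^{-t²/2} tⁿ L_d^{(n-1/2)}(t²)`: alternating critical values
# and a global Lipschitz bound

Sequel of `LaguerreSoninEnvelope.lean` / `LaguerreSoninOscillatory.lean` / `LaguerreSoninZeros.lean`
(normal form `w″ + Q w = 0`, Sonin functions `G = Q w² + w′²` and `F = w² + w′²/Q`, oscillatory interval
`(t₋, t₊)`, peak `t_M`, sign pattern of `w` between the zeros `√rᵢ` of `L_d^{(n-1/2)}(t²)`). This file proves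
the STRUCTURAL THEOREM consumed by the all-degree Jensen threshold for `ξ`
(`Literature/NumberTheory/LFunctions/JensenXiExponentialRange.lean`):

`exists_laguerreNormal_testPoints`: for `n ≥ 2`, `d ≥ 1` there are points `t₋ < t₀* < ⋯ < t_d* < t₊` and
`A > 0` with `(-1)^j w(t_j*) ≥ A` for every `j` and `|w(t) - w(s)| ≤ A √(4d+3) |t - s|` for all `s, t > 0`.

Steps (Szegő §6.31, §7.31): all zeros `√rᵢ` of `w` lie in `(t₋, t₊)` (a convex function vanishing at both
ends of `[0, √r₀]`, resp. convex, positive and tending to `0` beyond `√r_{d-1}`, is impossible); on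
`(0, t₋]` and `[t₊, ∞)` the slope of `w` is monotone and bounded by its value at `t_∓`, so `|w′| ≤ √G(t_M)`
on all of `(0, ∞)`; the `d + 1` critical points (Rolle between consecutive zeros, the mean value and
intermediate value theorems on the two outer gaps) have `|w| = √F ≥ √(G(t_M)/Q(t_M)) = A` and signs
`(-1)^j`; finally `Q(t_M) ≤ 4d + 3` turns `√G(t_M) = A√Q(t_M)` into the stated Lipschitz constant.

## References
* [Szego1975] G. Szegő, *Orthogonal Polynomials*, 4th ed. (1975), (5.1.2), Thm. 3.3.1, Thm. 6.31.2, Thm. 7.31.1.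
-/

noncomputable section

open Polynomial Set
open scoped Nat

namespace Literature.Analysis.SpecialFunctions

variable (n d : ℕ)

/-! ### The main structural theorem -/

/-- **Test points of the normal form.** For `n ≥ 2`, `d ≥ 1` there are `d + 1` points
`t₋ < t₀* < t₁* < ⋯ < t_d* < t₊` and an amplitude `A > 0` such that `(-1)^j w(t_j*) ≥ A` and `w` is
`A√(4d+3)`-Lipschitz on `(0, ∞)`. (The `t_j*` are the critical points of `w` on the `d + 1` gaps cut
out by the zeros of `L_d^{(n-1/2)}(t²)`, which all lie in the oscillatory interval `(t₋, t₊)`;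
`A = √(G(t_M)/Q(t_M))`; Sonin's monotonicity of `F` bounds the critical values from below and that of
`G` bounds `|w′|` from above.) [cite: Szego1975, Thm. 7.31.1] -/
theorem exists_laguerreNormal_testPoints (hn : 2 ≤ n) (hd : 1 ≤ d) :
    ∃ ts : Fin (d + 1) → ℝ, StrictMono ts ∧
      (∀ j, laguerreTMinus n d < ts j ∧ ts j < laguerreTPlus n d) ∧
      ∃ A : ℝ, 0 < A ∧ (∀ j : Fin (d + 1), A ≤ (-1) ^ (j : ℕ) * laguerreNormal n d (ts j)) ∧
        ∀ s t : ℝ, 0 < s → 0 < t →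
          |laguerreNormal n d t - laguerreNormal n d s| ≤ A * Real.sqrt (4 * d + 3) * |t - s| := by
  -- notation and basic facts
  set w := laguerreNormal n d with hw
  set w₁ := laguerreNormalDeriv n d with hw₁
  set Q := laguerreNormalQ n d with hQ
  set tm := laguerreTMinus n d with htm
  set tp := laguerreTPlus n d with htp
  obtain ⟨htm0, htmp⟩ := laguerreTMinus_pos_lt n d hn
  have htp0 : 0 < tp := htm0.trans htmp
  have hα : (-1 : ℝ) < (n : ℝ) - 1 / 2 := by
    have : (2 : ℝ) ≤ n := by exact_mod_cast hn
    linarith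
  obtain ⟨r, hr, hr0, hL⟩ :=
    laguerre_eq_C_mul_prod_pos_roots hα d
  set s : Fin d → ℝ := fun i => Real.sqrt (r i) with hs
  have hs_mono : StrictMono s := fun i j hij => Real.sqrt_lt_sqrt (hr0 i).le (hr hij)
  have hs0 : ∀ i, 0 < s i := fun i => Real.sqrt_pos.2 (hr0 i)
  have hws : ∀ i, w (s i) = 0 := laguerreNormal_sqrt_root n d hL hr0
  have hcont : Continuous w := continuous_laguerreNormal n d
  have hderw : ∀ t, 0 < t → HasDerivAt w (w₁ t) t := fun t ht =>
    hasDerivAt_laguerreNormal n d ht.ne'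
  have hderw₁ : ∀ t, 0 < t → HasDerivAt w₁ (-(Q t) * w t) t := fun t ht =>
    hasDerivAt_laguerreNormalDeriv n d ht.ne'
  have hw₁cont : ∀ a b, 0 < a → ContinuousOn w₁ (Icc a b) := fun a b ha t ht =>
    (hderw₁ t (lt_of_lt_of_le ha ht.1)).continuousAt.continuousWithinAt
  -- the gap predicate and the sign pattern
  have hsign : ∀ (j : ℕ), j ≤ d → ∀ t, 0 < t → (∀ i : Fin d, (i : ℕ) < j → s i < t) →
      (∀ i : Fin d, j ≤ (i : ℕ) → t < s i) → 0 < (-1) ^ j * w t :=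
    fun j hj t ht hlt hgt => laguerreNormal_gap_sign n d hL ht j hj hlt hgt
  -- indices `0` and `d - 1`
  set i0 : Fin d := ⟨0, hd⟩ with hi0
  set il : Fin d := ⟨d - 1, by omega⟩ with hil
  have hs_le_last : ∀ i : Fin d, s i ≤ s il :=
    fun i => hs_mono.monotone (Fin.le_def.2 (by simp [hil]; omega))
  have hs_first_le : ∀ i : Fin d, s i0 ≤ s i :=
    fun i => hs_mono.monotone (Fin.le_def.2 (by simp [hi0]))
  -- gap `0`: `w > 0` on `(0, s₀)`; gap `d`: `(-1)^d w > 0` on `(s_{d-1}, ∞)`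
  have hgap0 : ∀ t, 0 < t → t < s i0 → 0 < w t := by
    intro t ht hts
    have := hsign 0 d.zero_le t ht (fun i hi => absurd hi (Nat.not_lt_zero _))
      (fun i _ => lt_of_lt_of_le hts (hs_first_le i))
    simpa using this
  have hgapd : ∀ t, s il < t → 0 < (-1) ^ d * w t := by
    intro t hts
    exact hsign d le_rfl t ((hs0 il).trans hts) (fun i _ => lt_of_le_of_lt (hs_le_last i) hts)
      (fun i hi => absurd hi (by have := i.2; omega))
  -- (3a) the smallest zero exceeds `t₋`
  have h3a : tm < s i0 := by
    by_contra hcon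
    rw [not_lt] at hcon
    -- `w` convex on `[0, s₀]`, vanishing at both ends, positive inside: absurd
    have hconv : ConvexOn ℝ (Icc 0 (s i0)) (fun t => (1 : ℝ) * w t) := by
      refine convexOn_mul_laguerreNormal n d (convex_Icc _ _) ?_ hcont.continuousOn 1 ?_
      · rw [interior_Icc]; exact fun t ht => ht.1
      · intro t ht
        rw [interior_Icc] at ht
        have hQ' : Q t ≤ 0 := laguerreNormalQ_nonpos_of_not_mem n d hn ht.1
          (Or.inl (ht.2.le.trans hcon))
        have := hgap0 t ht.1 ht.2
        nlinarith
    have hmid := hconv.2 (left_mem_Icc.2 (hs0 i0).le) (right_mem_Icc.2 (hs0 i0).le)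
      (by norm_num : (0 : ℝ) ≤ 1 / 2) (by norm_num : (0 : ℝ) ≤ 1 / 2) (by norm_num)
    have hw0 : w 0 = 0 := by
      simp [hw, laguerreNormal, zero_pow (by omega : n ≠ 0)]
    simp only [smul_eq_mul, one_mul, hws, hw0, mul_zero, add_zero, zero_add] at hmid
    have := hgap0 (1 / 2 * s i0) (by have := hs0 i0; positivity)
      (by have := hs0 i0; linarith)
    linarith
  -- (3b) the largest zero is below `t₊`
  have h3b : s il < tp := by
    by_contra hcon
    rw [not_lt] at hcon
    set g : ℝ → ℝ := fun t => (-1) ^ d * w t with hg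
    have hconv : ConvexOn ℝ (Ici (s il)) g := by
      refine convexOn_mul_laguerreNormal n d (convex_Ici _) ?_ hcont.continuousOn _ ?_
      · rw [interior_Ici]; exact fun t ht => (hs0 il).trans ht
      · intro t ht
        rw [interior_Ici] at ht
        have hQ' : Q t ≤ 0 := laguerreNormalQ_nonpos_of_not_mem n d hn ((hs0 il).trans ht)
          (Or.inr (hcon.trans (le_of_lt ht)))
        have := hgapd t ht
        nlinarith
    -- MVT on `[s_l, s_l + 1]`: a point with positive derivative
    have hgder : ∀ t, 0 < t → HasDerivAt g ((-1) ^ d * w₁ t) t := fun t ht =>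
      (hderw t ht).const_mul _
    obtain ⟨ξ, hξ, hξeq⟩ := exists_hasDerivAt_eq_slope g (fun t => (-1) ^ d * w₁ t)
      (by linarith : s il < s il + 1) (hcont.continuousOn.const_smul ((-1 : ℝ) ^ d) |>.congr
        (fun t _ => by simp [hg]))
      (fun t ht => hgder t ((hs0 il).trans ht.1))
    have hgξ : 0 < g (s il + 1) := hgapd _ (by linarith)
    have hgsl : g (s il) = 0 := by simp [hg, hws]
    have hc : 0 < (-1) ^ d * w₁ ξ := by rw [hξeq, hgsl]; norm_num; exact hgξ
    -- tangent line at `ξ` forces `g → ∞`, contradicting `g → 0`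
    have hlin : ∀ t, ξ < t → g ξ + (-1) ^ d * w₁ ξ * (t - ξ) ≤ g t := by
      intro t hξt
      have h := hconv.le_slope_of_hasDerivAt (mem_Ici.2 hξ.1.le) (mem_Ici.2 (hξ.1.trans hξt).le)
        hξt (hgder ξ ((hs0 il).trans hξ.1))
      rw [slope_def_field] at h
      have := (le_div_iff₀ (sub_pos.2 hξt)).1 h
      linarith
    have hgξ0 : 0 < g ξ := hgapd ξ hξ.1
    have htend : Filter.Tendsto g Filter.atTop (nhds 0) := by
      simpa [hg] using (tendsto_laguerreNormal_atTop n d).const_mul ((-1 : ℝ) ^ d)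
    have hev := (htend.eventually (gt_mem_nhds hgξ0)).and (Filter.eventually_gt_atTop ξ)
    obtain ⟨t, ht1, ht2⟩ := hev.exists
    have := hlin t ht2
    nlinarith
  -- all zeros lie in `(t₋, t₊)`
  have hs_mem : ∀ i, tm < s i ∧ s i < tp := fun i =>
    ⟨lt_of_lt_of_le h3a (hs_first_le i), lt_of_le_of_lt (hs_le_last i) h3b⟩
  -- (4b) left region: `0 < w₁ t ≤ w₁ t₋` for `0 < t ≤ t₋`
  have hconvL : ConvexOn ℝ (Icc 0 tm) (fun t => (1 : ℝ) * w t) := by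
    refine convexOn_mul_laguerreNormal n d (convex_Icc _ _) ?_ hcont.continuousOn 1 ?_
    · rw [interior_Icc]; exact fun t ht => ht.1
    · intro t ht
      rw [interior_Icc] at ht
      have hQ' : Q t ≤ 0 := laguerreNormalQ_nonpos_of_not_mem n d hn ht.1 (Or.inl ht.2.le)
      have := hgap0 t ht.1 (ht.2.trans h3a)
      nlinarith
  have hconvL' : ConvexOn ℝ (Icc 0 tm) w := hconvL.congr fun t _ => one_mul _
  have hw0 : w 0 = 0 := by simp [hw, laguerreNormal, zero_pow (by omega : n ≠ 0)]
  have h4b : ∀ t, 0 < t → t ≤ tm → 0 < w₁ t ∧ w₁ t ≤ w₁ tm := by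
    intro t ht httm
    have hmem0 : (0 : ℝ) ∈ Icc 0 tm := left_mem_Icc.2 htm0.le
    have hmemt : t ∈ Icc 0 tm := ⟨ht.le, httm⟩
    have h1 : slope w 0 t ≤ w₁ t := hconvL'.slope_le_of_hasDerivAt hmem0 hmemt ht (hderw t ht)
    have hslope : 0 < slope w 0 t := by
      rw [slope_def_field, hw0, sub_zero, sub_zero]
      exact div_pos (hgap0 t ht (lt_of_le_of_lt httm h3a)) ht
    refine ⟨hslope.trans_le h1, ?_⟩
    rcases httm.eq_or_lt with h | h
    · rw [h]
    · have h2 : w₁ t ≤ slope w t tm :=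
        hconvL'.le_slope_of_hasDerivAt hmemt (right_mem_Icc.2 htm0.le) h (hderw t ht)
      have h3 : slope w t tm ≤ w₁ tm :=
        hconvL'.slope_le_of_hasDerivAt hmemt (right_mem_Icc.2 htm0.le) h (hderw tm htm0)
      exact h2.trans h3
  -- (4c) right region: `(-1)^d w₁ t₊ ≤ (-1)^d w₁ t ≤ 0` for `t ≥ t₊`, and `(-1)^d w₁ t₊ < 0`
  set g : ℝ → ℝ := fun t => (-1) ^ d * w t with hg
  have hgder : ∀ t, 0 < t → HasDerivAt g ((-1) ^ d * w₁ t) t := fun t ht =>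
    (hderw t ht).const_mul _
  have hconvR : ConvexOn ℝ (Ici tp) g := by
    refine convexOn_mul_laguerreNormal n d (convex_Ici _) ?_ hcont.continuousOn _ ?_
    · rw [interior_Ici]; exact fun t ht => htp0.trans ht
    · intro t ht
      rw [interior_Ici] at ht
      have hQ' : Q t ≤ 0 := laguerreNormalQ_nonpos_of_not_mem n d hn (htp0.trans ht)
        (Or.inr (le_of_lt ht))
      have := hgapd t (h3b.trans ht)
      nlinarith
  have htend : Filter.Tendsto g Filter.atTop (nhds 0) := by
    simpa [hg] using (tendsto_laguerreNormal_atTop n d).const_mul ((-1 : ℝ) ^ d)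
  -- no point `t₁ ≥ t₊` has `(-1)^d w₁ t₁ ≥ 0`... more precisely: positive slope is impossible,
  -- and zero slope at a point where `g > 0` is impossible too
  have hnotup : ∀ t₁, tp ≤ t₁ → 0 ≤ (-1) ^ d * w₁ t₁ → False := by
    intro t₁ ht₁ hc
    have hg1 : 0 < g t₁ := hgapd t₁ (h3b.trans_le ht₁)
    have hlin : ∀ t, t₁ < t → g t₁ + (-1) ^ d * w₁ t₁ * (t - t₁) ≤ g t := by
      intro t h
      have h' := hconvR.le_slope_of_hasDerivAt (mem_Ici.2 ht₁) (mem_Ici.2 (ht₁.trans h.le)) h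
        (hgder t₁ (htp0.trans_le ht₁))
      rw [slope_def_field] at h'
      have := (le_div_iff₀ (sub_pos.2 h)).1 h'
      linarith
    have hev := (htend.eventually (gt_mem_nhds hg1)).and (Filter.eventually_gt_atTop t₁)
    obtain ⟨t, ht1, ht2⟩ := hev.exists
    have := hlin t ht2
    nlinarith
  have h4c : ∀ t, tp ≤ t → (-1) ^ d * w₁ tp ≤ (-1) ^ d * w₁ t ∧ (-1) ^ d * w₁ t < 0 := by
    intro t ht
    refine ⟨?_, lt_of_not_ge (hnotup t ht)⟩
    rcases ht.eq_or_lt with h | h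
    · rw [h]
    · have h2 : (-1) ^ d * w₁ tp ≤ slope g tp t :=
        hconvR.le_slope_of_hasDerivAt (mem_Ici.2 le_rfl) (mem_Ici.2 ht) h (hgder tp htp0)
      have h3 : slope g tp t ≤ (-1) ^ d * w₁ t :=
        hconvR.slope_le_of_hasDerivAt (mem_Ici.2 le_rfl) (mem_Ici.2 ht) h (hgder t (htp0.trans_le ht))
      exact h2.trans h3
  -- the global slope bound `|w₁ t| ≤ √G_M` for `t > 0`
  set GM := soninG n d (laguerrePeak n) with hGM
  have hsq_abs : ∀ x : ℝ, x ^ 2 ≤ GM → |x| ≤ Real.sqrt GM := fun x hx =>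
    Real.abs_le_sqrt hx
  have hslope : ∀ t, 0 < t → |w₁ t| ≤ Real.sqrt GM := by
    intro t ht
    rcases le_or_gt t tm with h1 | h1
    · obtain ⟨hp, hle⟩ := h4b t ht h1
      have htm_sq := laguerreNormalDeriv_sq_le_of_mem n d hn le_rfl htmp.le
      have htm_pos : 0 < w₁ tm := (h4b tm htm0 le_rfl).1
      rw [abs_of_pos hp]
      exact hle.trans ((le_abs_self _).trans (hsq_abs _ htm_sq))
    rcases le_or_gt t tp with h2 | h2
    · exact hsq_abs _ (laguerreNormalDeriv_sq_le_of_mem n d hn h1.le h2)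
    · obtain ⟨hge, hneg⟩ := h4c t h2.le
      have htp_sq := laguerreNormalDeriv_sq_le_of_mem n d hn htmp.le le_rfl
      have key : |w₁ t| ≤ |w₁ tp| := by
        have e1 : |w₁ t| = |(-1 : ℝ) ^ d * w₁ t| := by
          rw [abs_mul, abs_pow, abs_neg, abs_one, one_pow, one_mul]
        have e2 : |w₁ tp| = |(-1 : ℝ) ^ d * w₁ tp| := by
          rw [abs_mul, abs_pow, abs_neg, abs_one, one_pow, one_mul]
        rw [e1, e2, abs_of_neg hneg, abs_of_neg (h4c tp le_rfl).2]
        linarith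
      exact key.trans (hsq_abs _ htp_sq)
  -- critical points on each gap
  have hGMpos_of : ∀ c, tm < c → c < tp → w₁ c = 0 → w c ≠ 0 → 0 < GM := by
    intro c h1 h2 hc hwc
    have hQc : 0 < Q c := (laguerreNormalQ_pos_iff n d hn (htm0.trans h1)).2 ⟨h1, h2⟩
    have : soninG n d c ≤ GM := soninG_le_peak n d hn (htm0.trans h1)
    have e : soninG n d c = Q c * w c ^ 2 + w₁ c ^ 2 := rfl
    rw [e, hc] at this
    nlinarith [pow_pos hQc 1, sq_pos_of_ne_zero hwc, mul_pos hQc (sq_pos_of_ne_zero hwc)]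
  -- existence of a critical point in gap `j` inside `(t₋, t₊)`
  have hcrit : ∀ j : Fin (d + 1), ∃ c, tm < c ∧ c < tp ∧ w₁ c = 0 ∧
      (∀ i : Fin d, (i : ℕ) < (j : ℕ) → s i < c) ∧ (∀ i : Fin d, (j : ℕ) ≤ (i : ℕ) → c < s i) := by
    intro j
    rcases Nat.eq_zero_or_pos (j : ℕ) with hj0 | hjpos
    · -- gap 0: MVT on `[t₋, s₀]`, then IVT for `w₁` on `[t₋, ξ]`
      obtain ⟨ξ, hξ, hξeq⟩ := exists_hasDerivAt_eq_slope w w₁ h3a hcont.continuousOn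
        (fun t ht => hderw t (htm0.trans ht.1))
      have hξneg : w₁ ξ < 0 := by
        rw [hξeq, hws]
        exact div_neg_of_neg_of_pos (by linarith [hgap0 tm htm0 h3a]) (sub_pos.2 h3a)
      have htmpos : 0 < w₁ tm := (h4b tm htm0 le_rfl).1
      obtain ⟨c, hc, hc0⟩ := intermediate_value_Ioo' hξ.1.le (hw₁cont tm ξ htm0) ⟨hξneg, htmpos⟩
      refine ⟨c, hc.1, hc.2.trans (hξ.2.trans (hs_mem i0).2), hc0, fun i hi => ?_, fun i _ => ?_⟩
      · rw [hj0] at hi; exact absurd hi (Nat.not_lt_zero _)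
      · exact lt_of_lt_of_le (hc.2.trans hξ.2) (hs_first_le i)
    rcases lt_or_ge (j : ℕ) d with hjd | hjd
    · -- inner gap: Rolle on `[s_{j-1}, s_j]`
      set ia : Fin d := ⟨(j : ℕ) - 1, by omega⟩ with hia
      set ib : Fin d := ⟨(j : ℕ), hjd⟩ with hib
      have hab : s ia < s ib := hs_mono (Fin.mk_lt_mk.2 (by omega))
      obtain ⟨c, hc, hc0⟩ := exists_hasDerivAt_eq_zero hab hcont.continuousOn
        ((hws ia).trans (hws ib).symm) (fun t ht => hderw t ((hs0 ia).trans ht.1))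
      refine ⟨c, (hs_mem ia).1.trans hc.1, hc.2.trans (hs_mem ib).2, hc0, fun i hi => ?_,
        fun i hi => ?_⟩
      · exact lt_of_le_of_lt (hs_mono.monotone (Fin.le_def.2 (by show (i : ℕ) ≤ (j : ℕ) - 1; omega))) hc.1
      · exact lt_of_lt_of_le hc.2 (hs_mono.monotone (Fin.le_def.2 (by show (j : ℕ) ≤ (i : ℕ); omega)))
    · -- gap d: MVT on `[s_{d-1}, t₊]` for `g`, then IVT for `(-1)^d w₁` on `[ξ, t₊]`
      have hjd' : (j : ℕ) = d := le_antisymm (Nat.lt_succ_iff.1 j.2) hjd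
      obtain ⟨ξ, hξ, hξeq⟩ := exists_hasDerivAt_eq_slope g (fun t => (-1) ^ d * w₁ t) h3b
        (hcont.continuousOn.const_smul ((-1 : ℝ) ^ d) |>.congr (fun t _ => by simp [hg]))
        (fun t ht => hgder t ((hs0 il).trans ht.1))
      have hξpos : 0 < (-1) ^ d * w₁ ξ := by
        rw [hξeq]
        have : g (s il) = 0 := by simp [hg, hws]
        rw [this, sub_zero]
        exact div_pos (hgapd tp h3b) (sub_pos.2 h3b)
      have htpneg : (-1) ^ d * w₁ tp < 0 := (h4c tp le_rfl).2
      have hcont' : ContinuousOn (fun t => (-1 : ℝ) ^ d * w₁ t) (Icc ξ tp) :=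
        (hw₁cont ξ tp ((hs0 il).trans hξ.1)).const_smul ((-1 : ℝ) ^ d) |>.congr
          (fun t _ => by simp)
      obtain ⟨c, hc, hc0⟩ := intermediate_value_Ioo' hξ.2.le hcont' ⟨htpneg, hξpos⟩
      have hc0' : w₁ c = 0 := by
        have h1 : ((-1 : ℝ) ^ d) ≠ 0 := pow_ne_zero _ (by norm_num)
        exact (mul_eq_zero.1 hc0).resolve_left h1
      refine ⟨c, (hs_mem il).1.trans (hξ.1.trans hc.1), hc.2, hc0', fun i _ => ?_, fun i hi => ?_⟩
      · exact lt_of_le_of_lt (hs_le_last i) (hξ.1.trans hc.1)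
      · exact absurd hi (by have := i.2; omega)
  choose ts hts_m hts_p hts_crit hts_lt hts_gt using hcrit
  -- the amplitude
  have hts_pos : ∀ j, 0 < ts j := fun j => htm0.trans (hts_m j)
  have hts_sign : ∀ j : Fin (d + 1), 0 < (-1) ^ (j : ℕ) * w (ts j) := fun j =>
    hsign j (Nat.lt_succ_iff.1 j.2) (ts j) (hts_pos j) (hts_lt j) (hts_gt j)
  have hGMpos : 0 < GM := by
    have h := hts_sign 0
    refine hGMpos_of (ts 0) (hts_m 0) (hts_p 0) (hts_crit 0) ?_
    intro h0; rw [h0] at h; simp at h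
  obtain ⟨hQMpos, hQMle⟩ := laguerreNormalQ_peak_pos_le n d hn
  set QM := laguerreNormalQ n d (laguerrePeak n) with hQM
  set A := Real.sqrt (GM / QM) with hA
  have hApos : 0 < A := Real.sqrt_pos.2 (div_pos hGMpos hQMpos)
  refine ⟨ts, ?_, fun j => ⟨hts_m j, hts_p j⟩, A, hApos, fun j => ?_, fun s₁ t₁ hs₁ ht₁ => ?_⟩
  · -- strictly increasing: `ts j < s_j < ts j'` for `j < j'`
    intro j j' hjj'
    have hjd : (j : ℕ) < d := by have := j'.2; omega
    calc ts j < s ⟨j, hjd⟩ := hts_gt j ⟨j, hjd⟩ le_rfl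
      _ < ts j' := hts_lt j' ⟨j, hjd⟩ (by simpa using hjj')
  · -- amplitude: `QM · w(t*)² ≥ GM`
    have hge := soninG_peak_le_of_deriv_eq_zero n d hn (hts_m j) (hts_p j) (hts_crit j)
    have hpos := hts_sign j
    have habs : |(-1 : ℝ) ^ (j : ℕ) * w (ts j)| = |w (ts j)| := by
      rw [abs_mul, abs_pow, abs_neg, abs_one, one_pow, one_mul]
    rw [← abs_of_pos hpos, habs]
    refine Real.sqrt_le_iff.2 ⟨abs_nonneg _, ?_⟩ |> fun h => by rw [hA]; exact h
    rw [sq_abs, div_le_iff₀ hQMpos]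
    linarith
  · -- Lipschitz via the mean value theorem
    have hkey : ∀ a b, 0 < a → a < b → |w b - w a| ≤ A * Real.sqrt (4 * d + 3) * |b - a| := by
      intro a b ha hab
      obtain ⟨ξ, hξ, hξeq⟩ := exists_hasDerivAt_eq_slope w w₁ hab hcont.continuousOn
        (fun t ht => hderw t (ha.trans ht.1))
      have hξ0 : 0 < ξ := ha.trans hξ.1
      have e : w b - w a = w₁ ξ * (b - a) := by
        rw [hξeq]; field_simp [(sub_pos.2 hab).ne']
      rw [e, abs_mul]
      refine mul_le_mul_of_nonneg_right ?_ (abs_nonneg _)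
      calc |w₁ ξ| ≤ Real.sqrt GM := hslope ξ hξ0
        _ = A * Real.sqrt QM := by
          rw [hA, ← Real.sqrt_mul (div_pos hGMpos hQMpos).le, div_mul_cancel₀ _ hQMpos.ne']
        _ ≤ A * Real.sqrt (4 * d + 3) :=
          mul_le_mul_of_nonneg_left (Real.sqrt_le_sqrt hQMle) hApos.le
    rcases lt_trichotomy s₁ t₁ with h | h | h
    · exact hkey s₁ t₁ hs₁ h
    · subst h; simp
    · rw [abs_sub_comm (w t₁), abs_sub_comm t₁]; exact hkey t₁ s₁ ht₁ h

end Literature.Analysis.SpecialFunctions
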